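import Summits.BirchSwinnertonDyer.BirchSwinnertonDyer.Theorems.KatoDescentTamePotSupersingularTameLowerPdescShape
import Summits.BirchSwinnertonDyer.Rank1Residual.X11b.KrausMinimalityGeneralTwo
import HarnessLib

/-!
# Route `KatoDescentTamePotSupersingular` (rung K8-t′ = KT, cell `bsd-potss`), child crux `TameLowerIntrinsicNonCM`
# (item stmt-BirchSwinnertonDyer-19618), registered stub `stub_intr_residualNonCM` (REDUCIBLE disjunct) — RECORDS part 03
# (10 classes: `80613e`, `92430c`, `135954bp`, `159642bq`, `274950cq`, `303282o`, `310806j`, `370890bj`, `399105o`, `437310bo`): the per-class LOWER half `MissingLowerBoundAt W 3` on INTRINSIC (t′) rank-0 classes with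
# `E[3]` reducible, from four PUBLISHED facts + ONE two-engine `3`-isogeny-descent certificate line per class
# (seat `bsd-potss-kt-pdesc`, ACCEL row (4) of planner bsd-potss-plan g14; `--supports stmt-BirchSwinnertonDyer-19618 --as helper`;
# closes NOTHING class-wide)

PARTITION (D-0054, cell bsd-potss): EXCLUDED-DOMAIN non-CM additive `p` · B4 (t′) (`e ∈ {3,4,6}`; here `p = 3`, Kodaira `III` (`e = 4`)),
`r_an = 0`, INTRINSIC classes (every member `3 ∣ #Ш_an`) × {`E[3]` reducible} — rows of the registered stub
`Sig.stub_intr_residualNonCM` of the birth skeleton v4 of 19618 (planner g15): on a reducible row `ρ̄` is not onto and the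
`3`-adic tower is not onto, so the row is off every Kurihara-certificate road of the skeleton. Per class; class-wide the stub
is Kato's Conj. 12.10 lower half at an additive potentially supersingular prime (OPEN). HONEST FRAMING: BSD is not proved by
any of this; nothing here is new mathematics; THEOREMS ONLY (no definition, no named fact, no `sorry`); nothing is booked here.

Each record instantiates `KTPdesc.missingLowerBoundAt_of_isIsogenous_ainvs_of_selmerGroup_ne_bot` (Selmer currency: classes
with no rational `3`-torsion anywhere in the class) or `KTPdesc.missingLowerBoundAt_of_isIsogenous_ainvs_of_shaWitness`
(Ш-witness currency: classes meeting rational `3`-torsion, where `3 ∣ #Ẽ(𝔽_ℓ)` at every good `ℓ` for every member) of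
`…TameLowerPdescShape.lean` on the literal Cremona model `W₀` of the certificate member; the conclusion holds at EVERY
globally minimal `W ∼_ℚ W₀` (binder `hiso` = the Cremona class datum). DECIDED IN THE KERNEL: `Δ ≠ 0`, global minimality
(`X11b.isGloballyMinimal_of_krausCriterion_support`: the support of `Δ` + Silverman / Kraus per prime) and, in the Selmer
currency, `3 ∤ #W₀(ℚ)_tors` from one odd good prime `ℓ` with `3 ∤ #Ẽ(𝔽_ℓ)` (`countPoints`). DISPLAYED binders: the
PUBLISHED named facts `hCT` (Cassels–Tate), `hCassels` (Cassels), `hGZK`, `hmod`; per class `hr` (`r_an = 0`, Cremona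
`allbsd`), `hs`/`hv` (`#Ш_an(W₀) = s`, `ord_3 s ≤ 2`; value quoted per docstring) and the certificate line `hSel :
Sel^(3)(W₀/ℚ) ≠ ⊥` resp. `hwit : ∃ x ∈ Ш(W₀), x ≠ 0, 3·x = 0`, whose EVIDENCE is quoted per record: the row of kit
**j257757** (this seat; engines 2χ `isogchi.gp` sha256 42175383… and 2cft `isogcft.gp` sha256 0e36e3a0… of cell
b2b-bsdres-sha-2, UNMODIFIED; two independent methods per kernel — Kummer side over the `S`-units of `L = ℚ(T)` vs.
class-field-theory side over the ray class group of `L` —, IDENTICAL `(ŝ, s_φ, m, excess)` on all 298 kernels run, both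
Poitou–Tate identities PASS, 112 null kernels with `ord_p #Ш_an = 0` on both sides all show excess `0`; `HOME/kt-pdesc/`).
Chain (PROVED in the tree below the named facts): `dim Ш(W₀)[φ] ≥ 1` ⇒ `Ш(W₀)[3] ≠ 0` (⇒ `Sel^(3)(W₀/ℚ) ≠ ⊥`) ⇒
`3 ∣ #Ш(W₀)` ⇒ `3² ∣ #Ш(W₀)` (Cassels–Tate) ⇒ `ord_3 #Ш_an(W₀) = 2 ≤ ord_3 #Ш(W₀)`; Cassels' isogeny invariance
carries the lower half to every member.

References: [SilvermanAEC2009] Thm. X.4.14, VII.1 Rem. 1.1, VII.3.1(b); [Kraus1989] Prop. 1–2; [MilneADT2006] Thm. I.7.3;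
[Miller2011LMS] Def. 1.1; [Cremona2006] Table 1; Schaefer, J. Number Theory 56 (1996) L. 3.8; [SchaeferStoll2004];
[Kato2004Asterisque] Conj. 12.10 (p. 224).
-/

set_option autoImplicit false
set_option linter.dupNamespace false

noncomputable section

open scoped Classical

open WeierstrassCurve Literature.NumberTheory.EllipticCurves
  Literature.NumberTheory.EllipticCurves.Rank1Residual
  Literature.NumberTheory.EllipticCurves.Rank1Residual.Typed
  Summit.BirchSwinnertonDyer.Rank1Residual

namespace Summit.BirchSwinnertonDyer.BirchSwinnertonDyer.Theorems

/-- **L₀ `MissingLowerBoundAt · 3` on the intrinsic (t′) class `80613e`** (`E[3]` reducible, image `B`; `N = 80613 =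
3^2·13^2·53`; Kodaira type `III` at `3` (`e = 4`); members: 80613e1 `#Ш_an = 9`, `#tors = 3`, `∏c = 36`, 80613e2
`#Ш_an = 9`, `#tors = 1`, `∏c = 12`; the class MEETS rational `3`-torsion, so `3 ∣ #Ẽ(𝔽_ℓ)` at every good `ℓ` for
every member and the Ш-witness currency is used). Certificate member `W₀ = 80613e2 = [0, 0, 1, -562344120,
-5132764649698]` (`#tors = 1`; Cremona `allbsd`: `r_an = 0`, `#Ш_an(W₀) = 9`, `ord_3 = 2`). Kernel-decided: `Δ(W₀) ≠
0`, global minimality (support of `Δ` = `[(3, 2, 9), (13, 2, 8), (53, 1, 2)]` as `(q, v_q N, v_q Δ)`;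
Silverman/Kraus disjunct per prime: 3:a, 13:a, 53:a). Binders: PUBLISHED `hCT`, `hCassels`, `hGZK`, `hmod`; per
class `hr`, `hs`/`hv`, `hwit : ∃ x ∈ Ш(W₀), x ≠ 0, 3·x = 0` — EVIDENCE: kit j257757 (this seat; 2χ `isogchi.gp`
42175383… / 2cft `isogcft.gp` 0e36e3a0…, unmodified, AGREE, duality PASS) row `80613e2`: rational `3`-isogeny `φ`
with kernel polynomial `x + 13689` (kernel field degree `d = 2`) onto `80613e1` (`#tors = 3`, `#Ш_an = 9`), `(s_φ,
ŝ, m, excess) = (2, 1, 1, 2)`, Mordell–Weil split at rank `0` `(q_φ, q_φ̂) = (1, 0)` ⇒ `dim Ш(W₀)[φ] = s_φ − q_φ = 1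
≥ 1` (and `dim Ш(80613e1)[φ̂] = 1`) ⇒ `Ш(W₀)[3] ≠ 0` (the Mordell–Weil part of `Sel^φ(W₀)`, `q_φ = dim_3
80613e1(ℚ)/φ(W₀(ℚ))`, is accounted EXACTLY at rank `0`); `hiso`: the Cremona class 80613e (2 curves). Per class;
nothing booked. [cite: SilvermanAEC2009, Thm. X.4.14 and VII.1 Remark 1.1] [cite: Miller2011LMS, §1 and Def. 1.1]
[cite: Cremona2006, Table 1 (Cremona label 80613e2)] -/
theorem KTPdesc.lower3_wit_80613e2 (hCT : exists_casselsTate_pairing (K := ℚ))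
    (hCassels : bsdRHS_eq_of_isIsogenous) (hGZK : rank_eq_analyticRank_of_analyticRank_le_one)
    (hmod : hasEntireLFunction_rat) (W₀ : WeierstrassCurve ℚ) (hW₀ : W₀ = ⟨0, 0, 1, -562344120, -5132764649698⟩)
    (hr : W₀.analyticRank = 0) {s : ℚ} (hs : shaAn W₀ = (s : ℂ)) (hv : padicValRat 3 s ≤ 2)
    (hwit : ∃ x : W₀.sha, x ≠ 0 ∧ 3 • x = 0) (W : WeierstrassCurve ℚ) [W.IsElliptic] [W.IsGloballyMinimal]
    (hiso : IsIsogenous W W₀) : MissingLowerBoundAt W 3 := by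
  subst hW₀
  haveI : Fact (Nat.Prime 3) := ⟨by norm_num⟩
  exact KTPdesc.missingLowerBoundAt_of_isIsogenous_ainvs_of_shaWitness hCT hCassels hGZK hmod
    0 0 1 (-562344120) (-5132764649698)
    (X11b.isGloballyMinimal_of_krausCriterion_support 0 0 1 (-562344120) (-5132764649698)
      [(3, 2, 9), (13, 2, 8), (53, 1, 2)]
      (by intro t ht; simp only [List.mem_cons, List.not_mem_nil, or_false] at ht; rcases ht with rfl | rfl | rfl <;> norm_num)
      (by decide +kernel) (by decide +kernel))
    (by decide +kernel) 3 hr hs hv hwit W hiso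

/-- **L₀ `MissingLowerBoundAt · 3` on the intrinsic (t′) class `92430c`** (`E[3]` reducible, image `B`; `N = 92430 =
2·3^2·5·13·79`; Kodaira type `III` at `3` (`e = 4`); members: 92430c1 `#Ш_an = 9`, `#tors = 3`, `∏c = 108`, 92430c2
`#Ш_an = 9`, `#tors = 1`, `∏c = 36`; the class MEETS rational `3`-torsion, so `3 ∣ #Ẽ(𝔽_ℓ)` at every good `ℓ` for
every member and the Ш-witness currency is used). Certificate member `W₀ = 92430c2 = [1, -1, 0, -43243534329,
-3461214624535315]` (`#tors = 1`; Cremona `allbsd`: `r_an = 0`, `#Ш_an(W₀) = 9`, `ord_3 = 2`). Kernel-decided: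
`Δ(W₀) ≠ 0`, global minimality (support of `Δ` = `[(2, 1, 15), (3, 2, 9), (5, 1, 2), (13, 1, 3), (79, 1, 3)]` as
`(q, v_q N, v_q Δ)`; Silverman/Kraus disjunct per prime: 2:a, 3:a, 5:a, 13:a, 79:a). Binders: PUBLISHED `hCT`,
`hCassels`, `hGZK`, `hmod`; per class `hr`, `hs`/`hv`, `hwit : ∃ x ∈ Ш(W₀), x ≠ 0, 3·x = 0` — EVIDENCE: kit j257757
(this seat; 2χ `isogchi.gp` 42175383… / 2cft `isogcft.gp` 0e36e3a0…, unmodified, AGREE, duality PASS) row `92430c2`: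
rational `3`-isogeny `φ` with kernel polynomial `x + 120062` (kernel field degree `d = 2`) onto `92430c1` (`#tors =
3`, `#Ш_an = 9`), `(s_φ, ŝ, m, excess) = (2, 1, 1, 2)`, Mordell–Weil split at rank `0` `(q_φ, q_φ̂) = (1, 0)` ⇒ `dim
Ш(W₀)[φ] = s_φ − q_φ = 1 ≥ 1` (and `dim Ш(92430c1)[φ̂] = 1`) ⇒ `Ш(W₀)[3] ≠ 0` (the Mordell–Weil part of `Sel^φ(W₀)`,
`q_φ = dim_3 92430c1(ℚ)/φ(W₀(ℚ))`, is accounted EXACTLY at rank `0`); `hiso`: the Cremona class 92430c (2 curves).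
Per class; nothing booked. [cite: SilvermanAEC2009, Thm. X.4.14 and VII.1 Remark 1.1] [cite: Miller2011LMS, §1 and
Def. 1.1] [cite: Cremona2006, Table 1 (Cremona label 92430c2)] -/
theorem KTPdesc.lower3_wit_92430c2 (hCT : exists_casselsTate_pairing (K := ℚ))
    (hCassels : bsdRHS_eq_of_isIsogenous) (hGZK : rank_eq_analyticRank_of_analyticRank_le_one)
    (hmod : hasEntireLFunction_rat) (W₀ : WeierstrassCurve ℚ) (hW₀ : W₀ = ⟨1, -1, 0, -43243534329, -3461214624535315⟩)
    (hr : W₀.analyticRank = 0) {s : ℚ} (hs : shaAn W₀ = (s : ℂ)) (hv : padicValRat 3 s ≤ 2)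
    (hwit : ∃ x : W₀.sha, x ≠ 0 ∧ 3 • x = 0) (W : WeierstrassCurve ℚ) [W.IsElliptic] [W.IsGloballyMinimal]
    (hiso : IsIsogenous W W₀) : MissingLowerBoundAt W 3 := by
  subst hW₀
  haveI : Fact (Nat.Prime 3) := ⟨by norm_num⟩
  exact KTPdesc.missingLowerBoundAt_of_isIsogenous_ainvs_of_shaWitness hCT hCassels hGZK hmod
    1 (-1) 0 (-43243534329) (-3461214624535315)
    (X11b.isGloballyMinimal_of_krausCriterion_support 1 (-1) 0 (-43243534329) (-3461214624535315)
      [(2, 1, 15), (3, 2, 9), (5, 1, 2), (13, 1, 3), (79, 1, 3)]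
      (by intro t ht; simp only [List.mem_cons, List.not_mem_nil, or_false] at ht; rcases ht with rfl | rfl | rfl | rfl | rfl <;> norm_num)
      (by decide +kernel) (by decide +kernel))
    (by decide +kernel) 3 hr hs hv hwit W hiso

/-- **L₀ `MissingLowerBoundAt · 3` on the intrinsic (t′) class `135954bp`** (`E[3]` reducible, image `B`; `N =
135954 = 2·3^2·7·13·83`; Kodaira type `III` at `3` (`e = 4`); members: 135954bp1 `#Ш_an = 9`, `#tors = 6`, `∏c =
72`, 135954bp2 `#Ш_an = 9`, `#tors = 6`, `∏c = 72`, 135954bp3 `#Ш_an = 9`, `#tors = 2`, `∏c = 24`, 135954bp4 `#Ш_an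
= 9`, `#tors = 2`, `∏c = 24`; the class MEETS rational `3`-torsion, so `3 ∣ #Ẽ(𝔽_ℓ)` at every good `ℓ` for every
member and the Ш-witness currency is used). Certificate member `W₀ = 135954bp3 = [1, -1, 0, -3817842, -2911022380]`
(`#tors = 2`; Cremona `allbsd`: `r_an = 0`, `#Ш_an(W₀) = 9`, `ord_3 = 2`). Kernel-decided: `Δ(W₀) ≠ 0`, global
minimality (support of `Δ` = `[(2, 1, 30), (3, 2, 9), (7, 1, 3), (13, 1, 2), (83, 1, 1)]` as `(q, v_q N, v_q Δ)`;
Silverman/Kraus disjunct per prime: 2:a, 3:a, 7:a, 13:a, 83:a). Binders: PUBLISHED `hCT`, `hCassels`, `hGZK`,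
`hmod`; per class `hr`, `hs`/`hv`, `hwit : ∃ x ∈ Ш(W₀), x ≠ 0, 3·x = 0` — EVIDENCE: kit j257757 (this seat; 2χ
`isogchi.gp` 42175383… / 2cft `isogcft.gp` 0e36e3a0…, unmodified, AGREE, duality PASS) row `135954bp3`: rational
`3`-isogeny `φ` with kernel polynomial `x + 812` (kernel field degree `d = 2`) onto `135954bp1` (`#tors = 6`, `#Ш_an
= 9`), `(s_φ, ŝ, m, excess) = (2, 1, 1, 2)`, Mordell–Weil split at rank `0` `(q_φ, q_φ̂) = (1, 0)` ⇒ `dim Ш(W₀)[φ] =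
s_φ − q_φ = 1 ≥ 1` (and `dim Ш(135954bp1)[φ̂] = 1`) ⇒ `Ш(W₀)[3] ≠ 0` (the Mordell–Weil part of `Sel^φ(W₀)`, `q_φ =
dim_3 135954bp1(ℚ)/φ(W₀(ℚ))`, is accounted EXACTLY at rank `0`); `hiso`: the Cremona class 135954bp (4 curves). Per
class; nothing booked. [cite: SilvermanAEC2009, Thm. X.4.14 and VII.1 Remark 1.1] [cite: Miller2011LMS, §1 and Def.
1.1] [cite: Cremona2006, Table 1 (Cremona label 135954bp3)] -/
theorem KTPdesc.lower3_wit_135954bp3 (hCT : exists_casselsTate_pairing (K := ℚ))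
    (hCassels : bsdRHS_eq_of_isIsogenous) (hGZK : rank_eq_analyticRank_of_analyticRank_le_one)
    (hmod : hasEntireLFunction_rat) (W₀ : WeierstrassCurve ℚ) (hW₀ : W₀ = ⟨1, -1, 0, -3817842, -2911022380⟩)
    (hr : W₀.analyticRank = 0) {s : ℚ} (hs : shaAn W₀ = (s : ℂ)) (hv : padicValRat 3 s ≤ 2)
    (hwit : ∃ x : W₀.sha, x ≠ 0 ∧ 3 • x = 0) (W : WeierstrassCurve ℚ) [W.IsElliptic] [W.IsGloballyMinimal]
    (hiso : IsIsogenous W W₀) : MissingLowerBoundAt W 3 := by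
  subst hW₀
  haveI : Fact (Nat.Prime 3) := ⟨by norm_num⟩
  exact KTPdesc.missingLowerBoundAt_of_isIsogenous_ainvs_of_shaWitness hCT hCassels hGZK hmod
    1 (-1) 0 (-3817842) (-2911022380)
    (X11b.isGloballyMinimal_of_krausCriterion_support 1 (-1) 0 (-3817842) (-2911022380)
      [(2, 1, 30), (3, 2, 9), (7, 1, 3), (13, 1, 2), (83, 1, 1)]
      (by intro t ht; simp only [List.mem_cons, List.not_mem_nil, or_false] at ht; rcases ht with rfl | rfl | rfl | rfl | rfl <;> norm_num)
      (by decide +kernel) (by decide +kernel))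
    (by decide +kernel) 3 hr hs hv hwit W hiso

/-- **L₀ `MissingLowerBoundAt · 3` on the intrinsic (t′) class `159642bq`** (`E[3]` reducible, image `B`; `N =
159642 = 2·3^2·7^2·181`; Kodaira type `III` at `3` (`e = 4`); members: 159642bq1 `#Ш_an = 9`, `#tors = 3`, `∏c =
36`, 159642bq2 `#Ш_an = 9`, `#tors = 1`, `∏c = 12`; the class MEETS rational `3`-torsion, so `3 ∣ #Ẽ(𝔽_ℓ)` at every
good `ℓ` for every member and the Ш-witness currency is used). Certificate member `W₀ = 159642bq2 = [1, -1, 0,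
151695759, -17385177432547]` (`#tors = 1`; Cremona `allbsd`: `r_an = 0`, `#Ш_an(W₀) = 9`, `ord_3 = 2`).
Kernel-decided: `Δ(W₀) ≠ 0`, global minimality (support of `Δ` = `[(2, 1, 45), (3, 2, 9), (7, 2, 8), (181, 1, 2)]`
as `(q, v_q N, v_q Δ)`; Silverman/Kraus disjunct per prime: 2:a, 3:a, 7:a, 181:a). Binders: PUBLISHED `hCT`,
`hCassels`, `hGZK`, `hmod`; per class `hr`, `hs`/`hv`, `hwit : ∃ x ∈ Ш(W₀), x ≠ 0, 3·x = 0` — EVIDENCE: kit j257757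
(this seat; 2χ `isogchi.gp` 42175383… / 2cft `isogcft.gp` 0e36e3a0…, unmodified, AGREE, duality PASS) row
`159642bq2`: rational `3`-isogeny `φ` with kernel polynomial `x + 110` (kernel field degree `d = 2`) onto
`159642bq1` (`#tors = 3`, `#Ш_an = 9`), `(s_φ, ŝ, m, excess) = (2, 1, 1, 2)`, Mordell–Weil split at rank `0` `(q_φ,
q_φ̂) = (1, 0)` ⇒ `dim Ш(W₀)[φ] = s_φ − q_φ = 1 ≥ 1` (and `dim Ш(159642bq1)[φ̂] = 1`) ⇒ `Ш(W₀)[3] ≠ 0` (the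
Mordell–Weil part of `Sel^φ(W₀)`, `q_φ = dim_3 159642bq1(ℚ)/φ(W₀(ℚ))`, is accounted EXACTLY at rank `0`); `hiso`:
the Cremona class 159642bq (2 curves). Per class; nothing booked. [cite: SilvermanAEC2009, Thm. X.4.14 and VII.1
Remark 1.1] [cite: Miller2011LMS, §1 and Def. 1.1] [cite: Cremona2006, Table 1 (Cremona label 159642bq2)] -/
theorem KTPdesc.lower3_wit_159642bq2 (hCT : exists_casselsTate_pairing (K := ℚ))
    (hCassels : bsdRHS_eq_of_isIsogenous) (hGZK : rank_eq_analyticRank_of_analyticRank_le_one)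
    (hmod : hasEntireLFunction_rat) (W₀ : WeierstrassCurve ℚ) (hW₀ : W₀ = ⟨1, -1, 0, 151695759, -17385177432547⟩)
    (hr : W₀.analyticRank = 0) {s : ℚ} (hs : shaAn W₀ = (s : ℂ)) (hv : padicValRat 3 s ≤ 2)
    (hwit : ∃ x : W₀.sha, x ≠ 0 ∧ 3 • x = 0) (W : WeierstrassCurve ℚ) [W.IsElliptic] [W.IsGloballyMinimal]
    (hiso : IsIsogenous W W₀) : MissingLowerBoundAt W 3 := by
  subst hW₀
  haveI : Fact (Nat.Prime 3) := ⟨by norm_num⟩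
  exact KTPdesc.missingLowerBoundAt_of_isIsogenous_ainvs_of_shaWitness hCT hCassels hGZK hmod
    1 (-1) 0 151695759 (-17385177432547)
    (X11b.isGloballyMinimal_of_krausCriterion_support 1 (-1) 0 151695759 (-17385177432547)
      [(2, 1, 45), (3, 2, 9), (7, 2, 8), (181, 1, 2)]
      (by intro t ht; simp only [List.mem_cons, List.not_mem_nil, or_false] at ht; rcases ht with rfl | rfl | rfl | rfl <;> norm_num)
      (by decide +kernel) (by decide +kernel))
    (by decide +kernel) 3 hr hs hv hwit W hiso

/-- **L₀ `MissingLowerBoundAt · 3` on the intrinsic (t′) class `274950cq`** (`E[3]` reducible, image `B`; `N =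
274950 = 2·3^2·5^2·13·47`; Kodaira type `III` at `3` (`e = 4`); members: 274950cq1 `#Ш_an = 9`, `#tors = 3`, `∏c =
108`, 274950cq2 `#Ш_an = 9`, `#tors = 1`, `∏c = 36`; the class MEETS rational `3`-torsion, so `3 ∣ #Ẽ(𝔽_ℓ)` at every
good `ℓ` for every member and the Ш-witness currency is used). Certificate member `W₀ = 274950cq2 = [1, -1, 0,
-5290939617, -148131129907459]` (`#tors = 1`; Cremona `allbsd`: `r_an = 0`, `#Ш_an(W₀) = 9`, `ord_3 = 2`).
Kernel-decided: `Δ(W₀) ≠ 0`, global minimality (support of `Δ` = `[(2, 1, 15), (3, 2, 9), (5, 2, 8), (13, 1, 6),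
(47, 1, 3)]` as `(q, v_q N, v_q Δ)`; Silverman/Kraus disjunct per prime: 2:a, 3:a, 5:a, 13:a, 47:a). Binders:
PUBLISHED `hCT`, `hCassels`, `hGZK`, `hmod`; per class `hr`, `hs`/`hv`, `hwit : ∃ x ∈ Ш(W₀), x ≠ 0, 3·x = 0` —
EVIDENCE: kit j257757 (this seat; 2χ `isogchi.gp` 42175383… / 2cft `isogcft.gp` 0e36e3a0…, unmodified, AGREE,
duality PASS) row `274950cq2`: rational `3`-isogeny `φ` with kernel polynomial `x + 41006` (kernel field degree `d =
2`) onto `274950cq1` (`#tors = 3`, `#Ш_an = 9`), `(s_φ, ŝ, m, excess) = (2, 1, 1, 2)`, Mordell–Weil split at rank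
`0` `(q_φ, q_φ̂) = (1, 0)` ⇒ `dim Ш(W₀)[φ] = s_φ − q_φ = 1 ≥ 1` (and `dim Ш(274950cq1)[φ̂] = 1`) ⇒ `Ш(W₀)[3] ≠ 0`
(the Mordell–Weil part of `Sel^φ(W₀)`, `q_φ = dim_3 274950cq1(ℚ)/φ(W₀(ℚ))`, is accounted EXACTLY at rank `0`);
`hiso`: the Cremona class 274950cq (2 curves). Per class; nothing booked. [cite: SilvermanAEC2009, Thm. X.4.14 and
VII.1 Remark 1.1] [cite: Miller2011LMS, §1 and Def. 1.1] [cite: Cremona2006, Table 1 (Cremona label 274950cq2)] -/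
theorem KTPdesc.lower3_wit_274950cq2 (hCT : exists_casselsTate_pairing (K := ℚ))
    (hCassels : bsdRHS_eq_of_isIsogenous) (hGZK : rank_eq_analyticRank_of_analyticRank_le_one)
    (hmod : hasEntireLFunction_rat) (W₀ : WeierstrassCurve ℚ) (hW₀ : W₀ = ⟨1, -1, 0, -5290939617, -148131129907459⟩)
    (hr : W₀.analyticRank = 0) {s : ℚ} (hs : shaAn W₀ = (s : ℂ)) (hv : padicValRat 3 s ≤ 2)
    (hwit : ∃ x : W₀.sha, x ≠ 0 ∧ 3 • x = 0) (W : WeierstrassCurve ℚ) [W.IsElliptic] [W.IsGloballyMinimal]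
    (hiso : IsIsogenous W W₀) : MissingLowerBoundAt W 3 := by
  subst hW₀
  haveI : Fact (Nat.Prime 3) := ⟨by norm_num⟩
  exact KTPdesc.missingLowerBoundAt_of_isIsogenous_ainvs_of_shaWitness hCT hCassels hGZK hmod
    1 (-1) 0 (-5290939617) (-148131129907459)
    (X11b.isGloballyMinimal_of_krausCriterion_support 1 (-1) 0 (-5290939617) (-148131129907459)
      [(2, 1, 15), (3, 2, 9), (5, 2, 8), (13, 1, 6), (47, 1, 3)]
      (by intro t ht; simp only [List.mem_cons, List.not_mem_nil, or_false] at ht; rcases ht with rfl | rfl | rfl | rfl | rfl <;> norm_num)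
      (by decide +kernel) (by decide +kernel))
    (by decide +kernel) 3 hr hs hv hwit W hiso

/-- **L₀ `MissingLowerBoundAt · 3` on the intrinsic (t′) class `303282o`** (`E[3]` reducible, image `B`; `N = 303282
= 2·3^2·7·29·83`; Kodaira type `III` at `3` (`e = 4`); members: 303282o1 `#Ш_an = 9`, `#tors = 3`, `∏c = 108`,
303282o2 `#Ш_an = 9`, `#tors = 1`, `∏c = 36`; the class MEETS rational `3`-torsion, so `3 ∣ #Ẽ(𝔽_ℓ)` at every good
`ℓ` for every member and the Ш-witness currency is used). Certificate member `W₀ = 303282o2 = [1, -1, 0,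
-64218098607, -6263731952845651]` (`#tors = 1`; Cremona `allbsd`: `r_an = 0`, `#Ш_an(W₀) = 9`, `ord_3 = 2`).
Kernel-decided: `Δ(W₀) ≠ 0`, global minimality (support of `Δ` = `[(2, 1, 18), (3, 2, 9), (7, 1, 3), (29, 1, 1),
(83, 1, 3)]` as `(q, v_q N, v_q Δ)`; Silverman/Kraus disjunct per prime: 2:a, 3:a, 7:a, 29:a, 83:a). Binders:
PUBLISHED `hCT`, `hCassels`, `hGZK`, `hmod`; per class `hr`, `hs`/`hv`, `hwit : ∃ x ∈ Ш(W₀), x ≠ 0, 3·x = 0` —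
EVIDENCE: kit j257757 (this seat; 2χ `isogchi.gp` 42175383… / 2cft `isogcft.gp` 0e36e3a0…, unmodified, AGREE,
duality PASS) row `303282o2`: rational `3`-isogeny `φ` with kernel polynomial `x + 146306` (kernel field degree `d =
2`) onto `303282o1` (`#tors = 3`, `#Ш_an = 9`), `(s_φ, ŝ, m, excess) = (2, 1, 1, 2)`, Mordell–Weil split at rank `0`
`(q_φ, q_φ̂) = (1, 0)` ⇒ `dim Ш(W₀)[φ] = s_φ − q_φ = 1 ≥ 1` (and `dim Ш(303282o1)[φ̂] = 1`) ⇒ `Ш(W₀)[3] ≠ 0` (the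
Mordell–Weil part of `Sel^φ(W₀)`, `q_φ = dim_3 303282o1(ℚ)/φ(W₀(ℚ))`, is accounted EXACTLY at rank `0`); `hiso`: the
Cremona class 303282o (2 curves). Per class; nothing booked. [cite: SilvermanAEC2009, Thm. X.4.14 and VII.1 Remark
1.1] [cite: Miller2011LMS, §1 and Def. 1.1] [cite: Cremona2006, Table 1 (Cremona label 303282o2)] -/
theorem KTPdesc.lower3_wit_303282o2 (hCT : exists_casselsTate_pairing (K := ℚ))
    (hCassels : bsdRHS_eq_of_isIsogenous) (hGZK : rank_eq_analyticRank_of_analyticRank_le_one)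
    (hmod : hasEntireLFunction_rat) (W₀ : WeierstrassCurve ℚ) (hW₀ : W₀ = ⟨1, -1, 0, -64218098607, -6263731952845651⟩)
    (hr : W₀.analyticRank = 0) {s : ℚ} (hs : shaAn W₀ = (s : ℂ)) (hv : padicValRat 3 s ≤ 2)
    (hwit : ∃ x : W₀.sha, x ≠ 0 ∧ 3 • x = 0) (W : WeierstrassCurve ℚ) [W.IsElliptic] [W.IsGloballyMinimal]
    (hiso : IsIsogenous W W₀) : MissingLowerBoundAt W 3 := by
  subst hW₀
  haveI : Fact (Nat.Prime 3) := ⟨by norm_num⟩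
  exact KTPdesc.missingLowerBoundAt_of_isIsogenous_ainvs_of_shaWitness hCT hCassels hGZK hmod
    1 (-1) 0 (-64218098607) (-6263731952845651)
    (X11b.isGloballyMinimal_of_krausCriterion_support 1 (-1) 0 (-64218098607) (-6263731952845651)
      [(2, 1, 18), (3, 2, 9), (7, 1, 3), (29, 1, 1), (83, 1, 3)]
      (by intro t ht; simp only [List.mem_cons, List.not_mem_nil, or_false] at ht; rcases ht with rfl | rfl | rfl | rfl | rfl <;> norm_num)
      (by decide +kernel) (by decide +kernel))
    (by decide +kernel) 3 hr hs hv hwit W hiso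

/-- **L₀ `MissingLowerBoundAt · 3` on the intrinsic (t′) class `310806j`** (`E[3]` reducible, image `B`; `N = 310806
= 2·3^2·31·557`; Kodaira type `III` at `3` (`e = 4`); members: 310806j1 `#Ш_an = 9`, `#tors = 3`, `∏c = 36`,
310806j2 `#Ш_an = 9`, `#tors = 1`, `∏c = 12`; the class MEETS rational `3`-torsion, so `3 ∣ #Ẽ(𝔽_ℓ)` at every good
`ℓ` for every member and the Ш-witness currency is used). Certificate member `W₀ = 310806j2 = [1, -1, 1, -439211,
-111926177]` (`#tors = 1`; Cremona `allbsd`: `r_an = 0`, `#Ш_an(W₀) = 9`, `ord_3 = 2`). Kernel-decided: `Δ(W₀) ≠ 0`,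
global minimality (support of `Δ` = `[(2, 1, 2), (3, 2, 9), (31, 1, 3), (557, 1, 1)]` as `(q, v_q N, v_q Δ)`;
Silverman/Kraus disjunct per prime: 2:a, 3:a, 31:a, 557:a). Binders: PUBLISHED `hCT`, `hCassels`, `hGZK`, `hmod`;
per class `hr`, `hs`/`hv`, `hwit : ∃ x ∈ Ш(W₀), x ≠ 0, 3·x = 0` — EVIDENCE: kit j257757 (this seat; 2χ `isogchi.gp`
42175383… / 2cft `isogcft.gp` 0e36e3a0…, unmodified, AGREE, duality PASS) row `310806j2`: rational `3`-isogeny `φ`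
with kernel polynomial `x + 380` (kernel field degree `d = 2`) onto `310806j1` (`#tors = 3`, `#Ш_an = 9`), `(s_φ, ŝ,
m, excess) = (2, 1, 1, 2)`, Mordell–Weil split at rank `0` `(q_φ, q_φ̂) = (1, 0)` ⇒ `dim Ш(W₀)[φ] = s_φ − q_φ = 1 ≥
1` (and `dim Ш(310806j1)[φ̂] = 1`) ⇒ `Ш(W₀)[3] ≠ 0` (the Mordell–Weil part of `Sel^φ(W₀)`, `q_φ = dim_3
310806j1(ℚ)/φ(W₀(ℚ))`, is accounted EXACTLY at rank `0`); `hiso`: the Cremona class 310806j (2 curves). Per class;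
nothing booked. [cite: SilvermanAEC2009, Thm. X.4.14 and VII.1 Remark 1.1] [cite: Miller2011LMS, §1 and Def. 1.1]
[cite: Cremona2006, Table 1 (Cremona label 310806j2)] -/
theorem KTPdesc.lower3_wit_310806j2 (hCT : exists_casselsTate_pairing (K := ℚ))
    (hCassels : bsdRHS_eq_of_isIsogenous) (hGZK : rank_eq_analyticRank_of_analyticRank_le_one)
    (hmod : hasEntireLFunction_rat) (W₀ : WeierstrassCurve ℚ) (hW₀ : W₀ = ⟨1, -1, 1, -439211, -111926177⟩)
    (hr : W₀.analyticRank = 0) {s : ℚ} (hs : shaAn W₀ = (s : ℂ)) (hv : padicValRat 3 s ≤ 2)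
    (hwit : ∃ x : W₀.sha, x ≠ 0 ∧ 3 • x = 0) (W : WeierstrassCurve ℚ) [W.IsElliptic] [W.IsGloballyMinimal]
    (hiso : IsIsogenous W W₀) : MissingLowerBoundAt W 3 := by
  subst hW₀
  haveI : Fact (Nat.Prime 3) := ⟨by norm_num⟩
  exact KTPdesc.missingLowerBoundAt_of_isIsogenous_ainvs_of_shaWitness hCT hCassels hGZK hmod
    1 (-1) 1 (-439211) (-111926177)
    (X11b.isGloballyMinimal_of_krausCriterion_support 1 (-1) 1 (-439211) (-111926177)
      [(2, 1, 2), (3, 2, 9), (31, 1, 3), (557, 1, 1)]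
      (by intro t ht; simp only [List.mem_cons, List.not_mem_nil, or_false] at ht; rcases ht with rfl | rfl | rfl | rfl <;> norm_num)
      (by decide +kernel) (by decide +kernel))
    (by decide +kernel) 3 hr hs hv hwit W hiso

/-- **L₀ `MissingLowerBoundAt · 3` on the intrinsic (t′) class `370890bj`** (`E[3]` reducible, image `B`; `N =
370890 = 2·3^2·5·13·317`; Kodaira type `III` at `3` (`e = 4`); members: 370890bj1 `#Ш_an = 9`, `#tors = 3`, `∏c =
36`, 370890bj2 `#Ш_an = 9`, `#tors = 1`, `∏c = 12`; the class MEETS rational `3`-torsion, so `3 ∣ #Ẽ(𝔽_ℓ)` at every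
good `ℓ` for every member and the Ш-witness currency is used). Certificate member `W₀ = 370890bj2 = [1, -1, 0,
-13884116514, 623854587580820]` (`#tors = 1`; Cremona `allbsd`: `r_an = 0`, `#Ш_an(W₀) = 9`, `ord_3 = 2`).
Kernel-decided: `Δ(W₀) ≠ 0`, global minimality (support of `Δ` = `[(2, 1, 63), (3, 2, 9), (5, 1, 2), (13, 1, 3),
(317, 1, 1)]` as `(q, v_q N, v_q Δ)`; Silverman/Kraus disjunct per prime: 2:a, 3:a, 5:a, 13:a, 317:a). Binders:
PUBLISHED `hCT`, `hCassels`, `hGZK`, `hmod`; per class `hr`, `hs`/`hv`, `hwit : ∃ x ∈ Ш(W₀), x ≠ 0, 3·x = 0` —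
EVIDENCE: kit j257757 (this seat; 2χ `isogchi.gp` 42175383… / 2cft `isogcft.gp` 0e36e3a0…, unmodified, AGREE,
duality PASS) row `370890bj2`: rational `3`-isogeny `φ` with kernel polynomial `x + 203852` (kernel field degree `d
= 2`) onto `370890bj1` (`#tors = 3`, `#Ш_an = 9`), `(s_φ, ŝ, m, excess) = (2, 1, 1, 2)`, Mordell–Weil split at rank
`0` `(q_φ, q_φ̂) = (1, 0)` ⇒ `dim Ш(W₀)[φ] = s_φ − q_φ = 1 ≥ 1` (and `dim Ш(370890bj1)[φ̂] = 1`) ⇒ `Ш(W₀)[3] ≠ 0`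
(the Mordell–Weil part of `Sel^φ(W₀)`, `q_φ = dim_3 370890bj1(ℚ)/φ(W₀(ℚ))`, is accounted EXACTLY at rank `0`);
`hiso`: the Cremona class 370890bj (2 curves). Per class; nothing booked. [cite: SilvermanAEC2009, Thm. X.4.14 and
VII.1 Remark 1.1] [cite: Miller2011LMS, §1 and Def. 1.1] [cite: Cremona2006, Table 1 (Cremona label 370890bj2)] -/
theorem KTPdesc.lower3_wit_370890bj2 (hCT : exists_casselsTate_pairing (K := ℚ))
    (hCassels : bsdRHS_eq_of_isIsogenous) (hGZK : rank_eq_analyticRank_of_analyticRank_le_one)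
    (hmod : hasEntireLFunction_rat) (W₀ : WeierstrassCurve ℚ) (hW₀ : W₀ = ⟨1, -1, 0, -13884116514, 623854587580820⟩)
    (hr : W₀.analyticRank = 0) {s : ℚ} (hs : shaAn W₀ = (s : ℂ)) (hv : padicValRat 3 s ≤ 2)
    (hwit : ∃ x : W₀.sha, x ≠ 0 ∧ 3 • x = 0) (W : WeierstrassCurve ℚ) [W.IsElliptic] [W.IsGloballyMinimal]
    (hiso : IsIsogenous W W₀) : MissingLowerBoundAt W 3 := by
  subst hW₀
  haveI : Fact (Nat.Prime 3) := ⟨by norm_num⟩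
  exact KTPdesc.missingLowerBoundAt_of_isIsogenous_ainvs_of_shaWitness hCT hCassels hGZK hmod
    1 (-1) 0 (-13884116514) 623854587580820
    (X11b.isGloballyMinimal_of_krausCriterion_support 1 (-1) 0 (-13884116514) 623854587580820
      [(2, 1, 63), (3, 2, 9), (5, 1, 2), (13, 1, 3), (317, 1, 1)]
      (by intro t ht; simp only [List.mem_cons, List.not_mem_nil, or_false] at ht; rcases ht with rfl | rfl | rfl | rfl | rfl <;> norm_num)
      (by decide +kernel) (by decide +kernel))
    (by decide +kernel) 3 hr hs hv hwit W hiso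

/-- **L₀ `MissingLowerBoundAt · 3` on the intrinsic (t′) class `399105o`** (`E[3]` reducible, image `B`; `N = 399105
= 3^2·5·7^2·181`; Kodaira type `III` at `3` (`e = 4`); members: 399105o1 `#Ш_an = 9`, `#tors = 3`, `∏c = 18`,
399105o2 `#Ш_an = 9`, `#tors = 1`, `∏c = 6`; the class MEETS rational `3`-torsion, so `3 ∣ #Ẽ(𝔽_ℓ)` at every good
`ℓ` for every member and the Ш-witness currency is used). Certificate member `W₀ = 399105o2 = [0, 0, 1, -1741068,
-935275336]` (`#tors = 1`; Cremona `allbsd`: `r_an = 0`, `#Ш_an(W₀) = 9`, `ord_3 = 2`). Kernel-decided: `Δ(W₀) ≠ 0`,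
global minimality (support of `Δ` = `[(3, 2, 9), (5, 1, 9), (7, 2, 8), (181, 1, 1)]` as `(q, v_q N, v_q Δ)`;
Silverman/Kraus disjunct per prime: 3:a, 5:a, 7:a, 181:a). Binders: PUBLISHED `hCT`, `hCassels`, `hGZK`, `hmod`; per
class `hr`, `hs`/`hv`, `hwit : ∃ x ∈ Ш(W₀), x ≠ 0, 3·x = 0` — EVIDENCE: kit j257757 (this seat; 2χ `isogchi.gp`
42175383… / 2cft `isogcft.gp` 0e36e3a0…, unmodified, AGREE, duality PASS) row `399105o2`: rational `3`-isogeny `φ`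
with kernel polynomial `x + 441` (kernel field degree `d = 2`) onto `399105o1` (`#tors = 3`, `#Ш_an = 9`), `(s_φ, ŝ,
m, excess) = (2, 1, 1, 2)`, Mordell–Weil split at rank `0` `(q_φ, q_φ̂) = (1, 0)` ⇒ `dim Ш(W₀)[φ] = s_φ − q_φ = 1 ≥
1` (and `dim Ш(399105o1)[φ̂] = 1`) ⇒ `Ш(W₀)[3] ≠ 0` (the Mordell–Weil part of `Sel^φ(W₀)`, `q_φ = dim_3
399105o1(ℚ)/φ(W₀(ℚ))`, is accounted EXACTLY at rank `0`); `hiso`: the Cremona class 399105o (2 curves). Per class;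
nothing booked. [cite: SilvermanAEC2009, Thm. X.4.14 and VII.1 Remark 1.1] [cite: Miller2011LMS, §1 and Def. 1.1]
[cite: Cremona2006, Table 1 (Cremona label 399105o2)] -/
theorem KTPdesc.lower3_wit_399105o2 (hCT : exists_casselsTate_pairing (K := ℚ))
    (hCassels : bsdRHS_eq_of_isIsogenous) (hGZK : rank_eq_analyticRank_of_analyticRank_le_one)
    (hmod : hasEntireLFunction_rat) (W₀ : WeierstrassCurve ℚ) (hW₀ : W₀ = ⟨0, 0, 1, -1741068, -935275336⟩)
    (hr : W₀.analyticRank = 0) {s : ℚ} (hs : shaAn W₀ = (s : ℂ)) (hv : padicValRat 3 s ≤ 2)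
    (hwit : ∃ x : W₀.sha, x ≠ 0 ∧ 3 • x = 0) (W : WeierstrassCurve ℚ) [W.IsElliptic] [W.IsGloballyMinimal]
    (hiso : IsIsogenous W W₀) : MissingLowerBoundAt W 3 := by
  subst hW₀
  haveI : Fact (Nat.Prime 3) := ⟨by norm_num⟩
  exact KTPdesc.missingLowerBoundAt_of_isIsogenous_ainvs_of_shaWitness hCT hCassels hGZK hmod
    0 0 1 (-1741068) (-935275336)
    (X11b.isGloballyMinimal_of_krausCriterion_support 0 0 1 (-1741068) (-935275336)
      [(3, 2, 9), (5, 1, 9), (7, 2, 8), (181, 1, 1)]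
      (by intro t ht; simp only [List.mem_cons, List.not_mem_nil, or_false] at ht; rcases ht with rfl | rfl | rfl | rfl <;> norm_num)
      (by decide +kernel) (by decide +kernel))
    (by decide +kernel) 3 hr hs hv hwit W hiso

/-- **L₀ `MissingLowerBoundAt · 3` on the intrinsic (t′) class `437310bo`** (`E[3]` reducible, image `B`; `N =
437310 = 2·3^2·5·43·113`; Kodaira type `III` at `3` (`e = 4`); members: 437310bo1 `#Ш_an = 9`, `#tors = 6`, `∏c =
288`, 437310bo2 `#Ш_an = 9`, `#tors = 6`, `∏c = 288`, 437310bo3 `#Ш_an = 9`, `#tors = 2`, `∏c = 96`, 437310bo4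
`#Ш_an = 9`, `#tors = 2`, `∏c = 96`; the class MEETS rational `3`-torsion, so `3 ∣ #Ẽ(𝔽_ℓ)` at every good `ℓ` for
every member and the Ш-witness currency is used). Certificate member `W₀ = 437310bo3 = [1, -1, 1, -11441063,
-14927303969]` (`#tors = 2`; Cremona `allbsd`: `r_an = 0`, `#Ш_an(W₀) = 9`, `ord_3 = 2`). Kernel-decided: `Δ(W₀) ≠
0`, global minimality (support of `Δ` = `[(2, 1, 8), (3, 2, 9), (5, 1, 3), (43, 1, 6), (113, 1, 1)]` as `(q, v_q N,
v_q Δ)`; Silverman/Kraus disjunct per prime: 2:a, 3:a, 5:a, 43:a, 113:a). Binders: PUBLISHED `hCT`, `hCassels`,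
`hGZK`, `hmod`; per class `hr`, `hs`/`hv`, `hwit : ∃ x ∈ Ш(W₀), x ≠ 0, 3·x = 0` — EVIDENCE: kit j257757 (this seat;
2χ `isogchi.gp` 42175383… / 2cft `isogcft.gp` 0e36e3a0…, unmodified, AGREE, duality PASS) row `437310bo3`: rational
`3`-isogeny `φ` with kernel polynomial `x + 1640` (kernel field degree `d = 2`) onto `437310bo1` (`#tors = 6`,
`#Ш_an = 9`), `(s_φ, ŝ, m, excess) = (2, 1, 1, 2)`, Mordell–Weil split at rank `0` `(q_φ, q_φ̂) = (1, 0)` ⇒ `dim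
Ш(W₀)[φ] = s_φ − q_φ = 1 ≥ 1` (and `dim Ш(437310bo1)[φ̂] = 1`) ⇒ `Ш(W₀)[3] ≠ 0` (the Mordell–Weil part of
`Sel^φ(W₀)`, `q_φ = dim_3 437310bo1(ℚ)/φ(W₀(ℚ))`, is accounted EXACTLY at rank `0`); `hiso`: the Cremona class
437310bo (4 curves). Per class; nothing booked. [cite: SilvermanAEC2009, Thm. X.4.14 and VII.1 Remark 1.1] [cite:
Miller2011LMS, §1 and Def. 1.1] [cite: Cremona2006, Table 1 (Cremona label 437310bo3)] -/
theorem KTPdesc.lower3_wit_437310bo3 (hCT : exists_casselsTate_pairing (K := ℚ))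
    (hCassels : bsdRHS_eq_of_isIsogenous) (hGZK : rank_eq_analyticRank_of_analyticRank_le_one)
    (hmod : hasEntireLFunction_rat) (W₀ : WeierstrassCurve ℚ) (hW₀ : W₀ = ⟨1, -1, 1, -11441063, -14927303969⟩)
    (hr : W₀.analyticRank = 0) {s : ℚ} (hs : shaAn W₀ = (s : ℂ)) (hv : padicValRat 3 s ≤ 2)
    (hwit : ∃ x : W₀.sha, x ≠ 0 ∧ 3 • x = 0) (W : WeierstrassCurve ℚ) [W.IsElliptic] [W.IsGloballyMinimal]
    (hiso : IsIsogenous W W₀) : MissingLowerBoundAt W 3 := by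
  subst hW₀
  haveI : Fact (Nat.Prime 3) := ⟨by norm_num⟩
  exact KTPdesc.missingLowerBoundAt_of_isIsogenous_ainvs_of_shaWitness hCT hCassels hGZK hmod
    1 (-1) 1 (-11441063) (-14927303969)
    (X11b.isGloballyMinimal_of_krausCriterion_support 1 (-1) 1 (-11441063) (-14927303969)
      [(2, 1, 8), (3, 2, 9), (5, 1, 3), (43, 1, 6), (113, 1, 1)]
      (by intro t ht; simp only [List.mem_cons, List.not_mem_nil, or_false] at ht; rcases ht with rfl | rfl | rfl | rfl | rfl <;> norm_num)
      (by decide +kernel) (by decide +kernel))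
    (by decide +kernel) 3 hr hs hv hwit W hiso

end Summit.BirchSwinnertonDyer.BirchSwinnertonDyer.Theorems

end
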